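import Summits.QuantumFields.YangMills.Theorems.BalabanUVNodesN09SupportClauseAtRecord

/-!
# NODE N09 [B12] — ROAD A′ RE-BASED ON THE χ-SUPPORT IS A TOWER CHART: the private-coordinate chart of the averaging of record, with the critical configuration as
# fallback off `{J ≠ 0} ∩ Φ⁻¹{χ^{(2.9)}_j ≠ 0}`, meets the four MEASURE-THEORETIC per-step sockets `hΦ hJ havgΦ hmap` of dag-n09-w1 g5's (F1) regularity tower VERBATIM

Cell `pub-ymgap` (YM-PLAN Track A), width seat `pub-ymgap-dag-n09-w5` g4 (D-0154 ∕ R399 (3a) width seat 5 of node N09), FILE 2; helper of K1⁸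
`StabilityBRunRowsAtRecordR13SepCoPH` = stmt-QuantumFields-26907 (`--supports`, `--as helper`, count-neutral).  [I] = [Balaban1987RG1] (CMP 109), [B11] = [Balaban1985Variational].

WHY.  dag-n09-w1 g5's REGULARITY TOWER (`…N09RegularityTowerOfGeometricChartData.hreg_pos_all_of_geometricChartData`, p622064) proves N09's `hreg_j` (and (F3)_j)
for all `j < K` from PER-STEP CHART DATA `(Z j, τ j, Φ j, J j, z₀ j)`; its measure-theoretic sockets are `hΦ`∕`hJ`, `havgΦ` (the chart lies over the coarse variable
EVERYWHERE on `domAlt_{j+1}`) and `hmap` (change of variables for `dU` restricted to `Ū⁻¹(domAlt_{j+1}) ∩ {χ^{(2.9)}_j ≠ 0}` — charted sets PINNED to the χ-support).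
dag-n09-w6 g3's ROAD A′ (`…N09HregOfPerBondChartsAtRecord` p620434 §2) assembles per-bond inversions `(Ω, T, ϑ, jd)` of the one-variable (0.4) averages in the private
coordinates `β(c)` into `Φ_tri (V, U) := extend β (c ↦ ϑ_c(U, V c)) U`, `J_tri (V, U) := 𝟙[∀ c, V c ∈ T_c U]·∏_c jd_c(U, V c)` over `Z := GaugeField (F.P K) j (SU N)`,
`τ := fieldMeasure` — but its `hmap` lives on the WINDOW set `{U | ∀ c, U(β c) ∈ Ω_c U}` and its fibre identity holds only where `J_tri ≠ 0`.  THIS FILE re-bases road A′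
so that it meets the tower's four sockets EXACTLY: with the REBASE SET `A := {p | J_tri p ≠ 0 ∧ Φ_tri p ∈ R}` (`R` measurable; at the record `R := {χ^{(2.9)}_j ≠ 0}`), the
TOWER CHART `Φ′ := A.piecewise Φ_tri (σ ∘ Prod.fst)` (fallback `σ` a section of `Ū` over the coarse set; at the record the critical configuration `V^{(j)}`, in the fibre by
`Node00.avg_critCfgOfRecord` under [B11]-existence `hsolν`) and the TOWER JACOBIAN `J′ := A.indicator J_tri` satisfy `hΦ`, `hJ`, `havgΦ` everywhere, and `hmap` ON `R` — from
road A′'s `hmap` restricted to `R` (`Measure.restrict_map`, `restrict_withDensity`, `withDensity_indicator`), the inclusion `Ū⁻¹(domAlt_{j+1}) ∩ R ⊆` window set (at the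
record THE SUPPORT CLAUSE of FILE 1 `…N09SupportClauseAtRecord`, p622515, in χ-form) and `Φ_tri = Φ′` a.e. for `J′·(dV ⊗ dU)` (`Measure.map_congr`).  The statements are
generic in the decidability instance of `A` (a `[DecidablePred (· ∈ A)]` binder).  The five REGULARITY sockets (`hconf hΦV hJV hΦc hJpos`, + `hz₀`) for `(Φ′, J′)` are
NOT here: they need the forward map's openness on the window interior, continuity of `ϑ`, `jd`, dag-n09-w3 g5's road-A′ `hnull` and a margin `α > (((d+2)L)²∕4)·ε₀`.

WHAT IS PROVED (theorems only; 0 def, 0 instance, 0 notation, 0 sorry).  One level `j < K` of a torus `K`; road-A′ data `Ω T ϑ jd` with dag-n09-w6 g3's binders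
`hΩm hTm hθm hjm hΩbl hright hlaw`; `R` measurable; `σ` measurable with `Ū(σ V) = V` on the coarse set.
* §1 `measurableSet_jacobian_ne_zero` · ★ `measurableSet_rebaseSet` · ★ `measurable_towerChart` · ★ `measurable_towerJacobian` · `towerChart_eq_of_mem` · `towerChart_eq_of_not_mem` ·
  ★ `avOfRecord_towerChart_eq` (`havgΦ` EVERYWHERE on the coarse set).
* §2 ★★★ `fieldMeasure_restrict_inter_eq_map_towerChart` (`dU⌊(Ū⁻¹U₀ ∩ R) = Φ′_*(((dV⌊U₀) ⊗ dU)·J′)` for every measurable coarse set `U₀`, from road A′'s `hmap` and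
  `Ū⁻¹U₀ ∩ R ⊆` the window set).
* The instantiation at the Stage-13 record (`R := {χ^{(2.9)}_j ≠ 0}`, `σ := V^{(j)}`, `Ω :=` the central α-window: the tower's four sockets from road-A′ data + `hsolν` +
  (H-U) `hU` + numerics) is the sequel file `…N09TowerChartOfPerBondChartsAtRecord` (400-line limit).

HONEST FRAMING.  LOCATED, count-neutral measure theory BY NAME; NO regularity socket, NO Jacobian law, NO `hnull`, NO chart of Bałaban's ((2.10)) constructed; [B11]-existence
`hsolν`, (H-U) `hU`, the per-bond inversion data and the numerics stay DISPLAYED; `hreg` NOT discharged; NOTHING of Bałaban's proved or denied; N09 NOT discharged; conjunct 1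
(Lemma 4) and FLAG №7 untouched; K0⁷ ∕ K1⁸ ∕ K3⁷ NOT closed; counts unmoved (typed 28∕28 · discharged 5∕28); no summit statement is proved by this seat; one finite four-torus
programme at fixed `ε = L^{−K}` per run — R4 closes the conditional rung `BalabanLadder.UV` only; NOT continuum ∕ ℝ⁴ ∕ infinite volume ∕ OS; the Yang–Mills mass gap (Clay) is
NOT proved by any of this.
-/

noncomputable section

namespace Summit.QuantumFields.YangMills.BalabanUVNodes.N09TowerChartOfPerBondCharts

open MeasureTheory Set Function
open scoped ENNReal NNReal
open Literature.MathematicalPhysics.QuantumFieldTheory.Balaban1983to89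
open Literature.MathematicalPhysics.QuantumFieldTheory.Balaban1983to89.T4Continuum (T4Family)
open Literature.MathematicalPhysics.QuantumFieldTheory.Balaban1983to89.Node00
open Literature.MathematicalPhysics.QuantumFieldTheory.Balaban1983to89.ExpMeanLog (deltaSU)
open Literature.MathematicalPhysics.QuantumFieldTheory.Balaban1983to89.BlockAveraging (Idx loopHol)
open Literature.MathematicalPhysics.QuantumFieldTheory.Balaban1983to89.BlockAveragingHaarAC (centralBond pre post)
open Literature.MathematicalPhysics.QuantumFieldTheory.Balaban1983to89.BlockAveragingEMLHaarAC (fibreFamily)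
open N09HregOfPerBondChartsAtRecord
  (measurable_triChart_record measurable_triJacobian_record avOfRecord_triChart_eq_of_jacobian_ne_zero fieldMeasure_restrict_eq_map_of_perBondCharts)

variable {F : T4Family} {N : ℕ} [NeZero N]

/-! ## §1  The rebase set, the tower chart, the tower Jacobian: measurability, agreement, the fibre identity everywhere -/

section Rebase

variable {K j : ℕ} (T : PBond (F.P K) (j + 1) → GaugeField (F.P K) j (SU N) → Set (SU N))
  (ϑ : PBond (F.P K) (j + 1) → GaugeField (F.P K) j (SU N) → SU N → SU N)
  (jd : PBond (F.P K) (j + 1) → GaugeField (F.P K) j (SU N) → SU N → ℝ≥0)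
  (R : Set (GaugeField (F.P K) j (SU N))) (σ : (PBond (F.P K) (j + 1) → SU N) → GaugeField (F.P K) j (SU N))

omit [NeZero N] in
/-- `{J_tri ≠ 0}` is measurable (road A′'s Jacobian is jointly measurable — dag-n09-w6 g3's `measurable_triJacobian_record`). [cite: Balaban1987RG1, (2.10) p.267 (bookkeeping)] -/
theorem measurableSet_jacobian_ne_zero (hTm : ∀ c, MeasurableSet {p : GaugeField (F.P K) j (SU N) × SU N | p.2 ∈ T c p.1})
    (hjm : ∀ c, Measurable fun p : GaugeField (F.P K) j (SU N) × SU N => jd c p.1 p.2) :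
    MeasurableSet {p : (PBond (F.P K) (j + 1) → SU N) × GaugeField (F.P K) j (SU N) |
      {q : (PBond (F.P K) (j + 1) → SU N) × GaugeField (F.P K) j (SU N) | ∀ c, q.1 c ∈ T c q.2}.indicator
        (fun q => ∏ c, jd c q.2 (q.1 c)) p ≠ 0} :=
  (measurable_triJacobian_record T jd hTm hjm) (measurableSet_singleton (0 : ℝ≥0)).compl

omit [NeZero N] in
/-- ★ **THE REBASE SET `A := {J_tri ≠ 0} ∩ Φ_tri⁻¹ R` IS MEASURABLE.** [cite: Balaban1987RG1, (2.10) p.267 (bookkeeping)] -/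
theorem measurableSet_rebaseSet (hj : j < K) (hTm : ∀ c, MeasurableSet {p : GaugeField (F.P K) j (SU N) × SU N | p.2 ∈ T c p.1})
    (hθm : ∀ c, Measurable fun p : GaugeField (F.P K) j (SU N) × SU N => ϑ c p.1 p.2)
    (hjm : ∀ c, Measurable fun p : GaugeField (F.P K) j (SU N) × SU N => jd c p.1 p.2) (hR : MeasurableSet R) :
    MeasurableSet {p : (PBond (F.P K) (j + 1) → SU N) × GaugeField (F.P K) j (SU N) |
      {q : (PBond (F.P K) (j + 1) → SU N) × GaugeField (F.P K) j (SU N) | ∀ c, q.1 c ∈ T c q.2}.indicator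
          (fun q => ∏ c, jd c q.2 (q.1 c)) p ≠ 0 ∧
        (extend centralBond (fun c => ϑ c p.2 (p.1 c)) p.2 : GaugeField (F.P K) j (SU N)) ∈ R} :=
  (measurableSet_jacobian_ne_zero T jd hTm hjm).inter (measurable_triChart_record ϑ hj hθm hR)

omit [NeZero N] in
/-- ★ **THE TOWER CHART `Φ′ := A.piecewise Φ_tri (σ ∘ Prod.fst)` IS MEASURABLE** (for a measurable fallback `σ`). [cite: Balaban1987RG1, (2.10) p.267 (bookkeeping)] -/
theorem measurable_towerChart (hj : j < K) (hTm : ∀ c, MeasurableSet {p : GaugeField (F.P K) j (SU N) × SU N | p.2 ∈ T c p.1})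
    (hθm : ∀ c, Measurable fun p : GaugeField (F.P K) j (SU N) × SU N => ϑ c p.1 p.2)
    (hjm : ∀ c, Measurable fun p : GaugeField (F.P K) j (SU N) × SU N => jd c p.1 p.2) (hR : MeasurableSet R) (hσ : Measurable σ)
    [DecidablePred (· ∈ {p : (PBond (F.P K) (j + 1) → SU N) × GaugeField (F.P K) j (SU N) |
      {q : (PBond (F.P K) (j + 1) → SU N) × GaugeField (F.P K) j (SU N) | ∀ c, q.1 c ∈ T c q.2}.indicator
          (fun q => ∏ c, jd c q.2 (q.1 c)) p ≠ 0 ∧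
        (extend centralBond (fun c => ϑ c p.2 (p.1 c)) p.2 : GaugeField (F.P K) j (SU N)) ∈ R})] :
    Measurable fun p : (PBond (F.P K) (j + 1) → SU N) × GaugeField (F.P K) j (SU N) =>
      {p : (PBond (F.P K) (j + 1) → SU N) × GaugeField (F.P K) j (SU N) |
          {q : (PBond (F.P K) (j + 1) → SU N) × GaugeField (F.P K) j (SU N) | ∀ c, q.1 c ∈ T c q.2}.indicator
              (fun q => ∏ c, jd c q.2 (q.1 c)) p ≠ 0 ∧
            (extend centralBond (fun c => ϑ c p.2 (p.1 c)) p.2 : GaugeField (F.P K) j (SU N)) ∈ R}.piecewise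
        (fun p => (extend centralBond (fun c => ϑ c p.2 (p.1 c)) p.2 : GaugeField (F.P K) j (SU N))) (fun p => σ p.1) p :=
  Measurable.piecewise (measurableSet_rebaseSet T ϑ jd R hj hTm hθm hjm hR) (measurable_triChart_record ϑ hj hθm) (hσ.comp measurable_fst)

omit [NeZero N] in
/-- ★ **THE TOWER JACOBIAN `J′ := A.indicator J_tri` IS MEASURABLE.** [cite: Balaban1987RG1, (2.10) p.267 (bookkeeping)] -/
theorem measurable_towerJacobian (hj : j < K) (hTm : ∀ c, MeasurableSet {p : GaugeField (F.P K) j (SU N) × SU N | p.2 ∈ T c p.1})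
    (hθm : ∀ c, Measurable fun p : GaugeField (F.P K) j (SU N) × SU N => ϑ c p.1 p.2)
    (hjm : ∀ c, Measurable fun p : GaugeField (F.P K) j (SU N) × SU N => jd c p.1 p.2) (hR : MeasurableSet R) :
    Measurable fun p : (PBond (F.P K) (j + 1) → SU N) × GaugeField (F.P K) j (SU N) =>
      {p : (PBond (F.P K) (j + 1) → SU N) × GaugeField (F.P K) j (SU N) |
          {q : (PBond (F.P K) (j + 1) → SU N) × GaugeField (F.P K) j (SU N) | ∀ c, q.1 c ∈ T c q.2}.indicator
              (fun q => ∏ c, jd c q.2 (q.1 c)) p ≠ 0 ∧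
            (extend centralBond (fun c => ϑ c p.2 (p.1 c)) p.2 : GaugeField (F.P K) j (SU N)) ∈ R}.indicator
        ({q : (PBond (F.P K) (j + 1) → SU N) × GaugeField (F.P K) j (SU N) | ∀ c, q.1 c ∈ T c q.2}.indicator
          fun q => ∏ c, jd c q.2 (q.1 c)) p :=
  (measurable_triJacobian_record T jd hTm hjm).indicator (measurableSet_rebaseSet T ϑ jd R hj hTm hθm hjm hR)

omit [NeZero N] in
/-- On the rebase set the tower chart IS road A′'s chart. [cite: Balaban1987RG1, (2.10) p.267 (bookkeeping)] -/
theorem towerChart_eq_of_mem [DecidablePred (· ∈ {p : (PBond (F.P K) (j + 1) → SU N) × GaugeField (F.P K) j (SU N) |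
      {q : (PBond (F.P K) (j + 1) → SU N) × GaugeField (F.P K) j (SU N) | ∀ c, q.1 c ∈ T c q.2}.indicator
          (fun q => ∏ c, jd c q.2 (q.1 c)) p ≠ 0 ∧
        (extend centralBond (fun c => ϑ c p.2 (p.1 c)) p.2 : GaugeField (F.P K) j (SU N)) ∈ R})]
    {p : (PBond (F.P K) (j + 1) → SU N) × GaugeField (F.P K) j (SU N)}
    (hp : p ∈ {p : (PBond (F.P K) (j + 1) → SU N) × GaugeField (F.P K) j (SU N) |
      {q : (PBond (F.P K) (j + 1) → SU N) × GaugeField (F.P K) j (SU N) | ∀ c, q.1 c ∈ T c q.2}.indicator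
          (fun q => ∏ c, jd c q.2 (q.1 c)) p ≠ 0 ∧
        (extend centralBond (fun c => ϑ c p.2 (p.1 c)) p.2 : GaugeField (F.P K) j (SU N)) ∈ R}) :
    {p : (PBond (F.P K) (j + 1) → SU N) × GaugeField (F.P K) j (SU N) |
        {q : (PBond (F.P K) (j + 1) → SU N) × GaugeField (F.P K) j (SU N) | ∀ c, q.1 c ∈ T c q.2}.indicator
            (fun q => ∏ c, jd c q.2 (q.1 c)) p ≠ 0 ∧
          (extend centralBond (fun c => ϑ c p.2 (p.1 c)) p.2 : GaugeField (F.P K) j (SU N)) ∈ R}.piecewise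
        (fun p => (extend centralBond (fun c => ϑ c p.2 (p.1 c)) p.2 : GaugeField (F.P K) j (SU N))) (fun p => σ p.1) p =
      extend centralBond (fun c => ϑ c p.2 (p.1 c)) p.2 :=
  Set.piecewise_eq_of_mem _ _ _ hp

omit [NeZero N] in
/-- Off the rebase set the tower chart is the fallback `σ` of the coarse variable. [cite: Balaban1987RG1, (2.3) p.265 and (2.10) p.267 (bookkeeping)] -/
theorem towerChart_eq_of_not_mem [DecidablePred (· ∈ {p : (PBond (F.P K) (j + 1) → SU N) × GaugeField (F.P K) j (SU N) |
      {q : (PBond (F.P K) (j + 1) → SU N) × GaugeField (F.P K) j (SU N) | ∀ c, q.1 c ∈ T c q.2}.indicator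
          (fun q => ∏ c, jd c q.2 (q.1 c)) p ≠ 0 ∧
        (extend centralBond (fun c => ϑ c p.2 (p.1 c)) p.2 : GaugeField (F.P K) j (SU N)) ∈ R})]
    {p : (PBond (F.P K) (j + 1) → SU N) × GaugeField (F.P K) j (SU N)}
    (hp : p ∉ {p : (PBond (F.P K) (j + 1) → SU N) × GaugeField (F.P K) j (SU N) |
      {q : (PBond (F.P K) (j + 1) → SU N) × GaugeField (F.P K) j (SU N) | ∀ c, q.1 c ∈ T c q.2}.indicator
          (fun q => ∏ c, jd c q.2 (q.1 c)) p ≠ 0 ∧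
        (extend centralBond (fun c => ϑ c p.2 (p.1 c)) p.2 : GaugeField (F.P K) j (SU N)) ∈ R}) :
    {p : (PBond (F.P K) (j + 1) → SU N) × GaugeField (F.P K) j (SU N) |
        {q : (PBond (F.P K) (j + 1) → SU N) × GaugeField (F.P K) j (SU N) | ∀ c, q.1 c ∈ T c q.2}.indicator
            (fun q => ∏ c, jd c q.2 (q.1 c)) p ≠ 0 ∧
          (extend centralBond (fun c => ϑ c p.2 (p.1 c)) p.2 : GaugeField (F.P K) j (SU N)) ∈ R}.piecewise
        (fun p => (extend centralBond (fun c => ϑ c p.2 (p.1 c)) p.2 : GaugeField (F.P K) j (SU N))) (fun p => σ p.1) p = σ p.1 :=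
  Set.piecewise_eq_of_notMem _ _ _ hp

/-- ★ **THE TOWER CHART LIES OVER THE COARSE VARIABLE EVERYWHERE ON THE COARSE SET** (the tower's `havgΦ` socket): on `A` by road A′'s support-form fibre identity
(`avOfRecord_triChart_eq_of_jacobian_ne_zero`, from `hright`), off `A` by the fallback's section property `Ū(σ V) = V` (at the record: `Node00.avg_critCfgOfRecord` under
[B11]-existence). [cite: Balaban1987RG1, (2.3)–(2.4) pp.265–266 and (2.10) p.267] -/
theorem avOfRecord_towerChart_eq [DecidableEq (PBond (F.P K) j)]
    [DecidablePred (· ∈ {p : (PBond (F.P K) (j + 1) → SU N) × GaugeField (F.P K) j (SU N) |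
      {q : (PBond (F.P K) (j + 1) → SU N) × GaugeField (F.P K) j (SU N) | ∀ c, q.1 c ∈ T c q.2}.indicator
          (fun q => ∏ c, jd c q.2 (q.1 c)) p ≠ 0 ∧
        (extend centralBond (fun c => ϑ c p.2 (p.1 c)) p.2 : GaugeField (F.P K) j (SU N)) ∈ R})] (hj : j < K)
    (hright : ∀ c U, ∀ v ∈ T c U, (avOfRecord F N K j).avg (update U (centralBond c) (ϑ c U v)) c = v)
    {U₀ : Set (PBond (F.P K) (j + 1) → SU N)} (hσ : ∀ V ∈ U₀, (avOfRecord F N K j).avg (σ V) = V) :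
    ∀ V ∈ U₀, ∀ z : GaugeField (F.P K) j (SU N), (avOfRecord F N K j).avg
      ({p : (PBond (F.P K) (j + 1) → SU N) × GaugeField (F.P K) j (SU N) |
          {q : (PBond (F.P K) (j + 1) → SU N) × GaugeField (F.P K) j (SU N) | ∀ c, q.1 c ∈ T c q.2}.indicator
              (fun q => ∏ c, jd c q.2 (q.1 c)) p ≠ 0 ∧
            (extend centralBond (fun c => ϑ c p.2 (p.1 c)) p.2 : GaugeField (F.P K) j (SU N)) ∈ R}.piecewise
        (fun p => (extend centralBond (fun c => ϑ c p.2 (p.1 c)) p.2 : GaugeField (F.P K) j (SU N))) (fun p => σ p.1) (V, z)) = V := by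
  intro V hV z
  by_cases hp : (V, z) ∈ {p : (PBond (F.P K) (j + 1) → SU N) × GaugeField (F.P K) j (SU N) |
      {q : (PBond (F.P K) (j + 1) → SU N) × GaugeField (F.P K) j (SU N) | ∀ c, q.1 c ∈ T c q.2}.indicator
          (fun q => ∏ c, jd c q.2 (q.1 c)) p ≠ 0 ∧
        (extend centralBond (fun c => ϑ c p.2 (p.1 c)) p.2 : GaugeField (F.P K) j (SU N)) ∈ R}
  · rw [towerChart_eq_of_mem T ϑ jd R σ hp]
    exact avOfRecord_triChart_eq_of_jacobian_ne_zero T ϑ jd hj hright hp.1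
  · rw [towerChart_eq_of_not_mem T ϑ jd R σ hp]
    exact hσ V hV

end Rebase

/-! ## §2  The change-of-variables identity of the tower chart ON `R`, from road A′'s identity on the window set -/

section Map

variable {K j : ℕ} (Ω T : PBond (F.P K) (j + 1) → GaugeField (F.P K) j (SU N) → Set (SU N))
  (ϑ : PBond (F.P K) (j + 1) → GaugeField (F.P K) j (SU N) → SU N → SU N)
  (jd : PBond (F.P K) (j + 1) → GaugeField (F.P K) j (SU N) → SU N → ℝ≥0)
  (R : Set (GaugeField (F.P K) j (SU N))) (σ : (PBond (F.P K) (j + 1) → SU N) → GaugeField (F.P K) j (SU N))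

/-- ★★★ **THE TOWER CHART'S CHANGE OF VARIABLES ON `R`**: for every measurable coarse set `U₀` with `Ū⁻¹U₀ ∩ R` INSIDE THE WINDOW SET `{U | ∀ c, U(β c) ∈ Ω_c U}` (`hRW` —
at the record the support clause of FILE 1), `dU⌊(Ū⁻¹U₀ ∩ R) = Φ′_*(((dV⌊U₀) ⊗ dU)·J′)` — road A′'s identity on the window set (dag-n09-w6 g3's
`fieldMeasure_restrict_eq_map_of_perBondCharts`) restricted to `R` (`Measure.restrict_map`, `restrict_withDensity`, `withDensity_indicator`), the density `𝟙_{Φ_tri⁻¹R}·J_tri`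
being `J′` pointwise, and `Φ_tri = Φ′` almost everywhere for `J′·(dV ⊗ dU)` (`ae_withDensity_iff`, `Measure.map_congr`).  The per-bond inversions are displayed, not constructed.
[cite: Balaban1987RG1, (0.4) p.253, (2.4) p.266, (2.9)–(2.10) pp.266–267 and (0.13) p.254] -/
theorem fieldMeasure_restrict_inter_eq_map_towerChart [DecidableEq (PBond (F.P K) j)]
    [DecidablePred (· ∈ {p : (PBond (F.P K) (j + 1) → SU N) × GaugeField (F.P K) j (SU N) |
      {q : (PBond (F.P K) (j + 1) → SU N) × GaugeField (F.P K) j (SU N) | ∀ c, q.1 c ∈ T c q.2}.indicator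
          (fun q => ∏ c, jd c q.2 (q.1 c)) p ≠ 0 ∧
        (extend centralBond (fun c => ϑ c p.2 (p.1 c)) p.2 : GaugeField (F.P K) j (SU N)) ∈ R})] (hj : j < K)
    (hΩm : ∀ c, MeasurableSet {p : GaugeField (F.P K) j (SU N) × SU N | p.2 ∈ Ω c p.1})
    (hTm : ∀ c, MeasurableSet {p : GaugeField (F.P K) j (SU N) × SU N | p.2 ∈ T c p.1})
    (hθm : ∀ c, Measurable fun p : GaugeField (F.P K) j (SU N) × SU N => ϑ c p.1 p.2)
    (hjm : ∀ c, Measurable fun p : GaugeField (F.P K) j (SU N) × SU N => jd c p.1 p.2)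
    (hΩbl : ∀ c (U : GaugeField (F.P K) j (SU N)) (g : PBond (F.P K) (j + 1) → SU N), Ω c (extend centralBond g U) = Ω c U)
    (hright : ∀ c U, ∀ v ∈ T c U, (avOfRecord F N K j).avg (update U (centralBond c) (ϑ c U v)) c = v)
    (hlaw : ∀ c U, (HaarData.haar : Measure (SU N)).restrict (Ω c U) =
      (((HaarData.haar : Measure (SU N)).restrict (T c U)).withDensity fun v => (jd c U v : ℝ≥0∞)).map (ϑ c U))
    {U₀ : Set (PBond (F.P K) (j + 1) → SU N)} (hU₀ : MeasurableSet U₀) (hR : MeasurableSet R)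
    (hRW : (avOfRecord F N K j).avg ⁻¹' U₀ ∩ R ⊆ {U | ∀ c, U (centralBond c) ∈ Ω c U}) :
    (fieldMeasure (F.P K) j (SU N)).restrict ((avOfRecord F N K j).avg ⁻¹' U₀ ∩ R) =
      ((((piHaar (F.P K) (j + 1) (SU N)).restrict U₀).prod (fieldMeasure (F.P K) j (SU N))).withDensity fun p =>
          (({p : (PBond (F.P K) (j + 1) → SU N) × GaugeField (F.P K) j (SU N) |
              {q : (PBond (F.P K) (j + 1) → SU N) × GaugeField (F.P K) j (SU N) | ∀ c, q.1 c ∈ T c q.2}.indicator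
                  (fun q => ∏ c, jd c q.2 (q.1 c)) p ≠ 0 ∧
                (extend centralBond (fun c => ϑ c p.2 (p.1 c)) p.2 : GaugeField (F.P K) j (SU N)) ∈ R}.indicator
            ({q : (PBond (F.P K) (j + 1) → SU N) × GaugeField (F.P K) j (SU N) | ∀ c, q.1 c ∈ T c q.2}.indicator
              fun q => ∏ c, jd c q.2 (q.1 c)) p : ℝ≥0) : ℝ≥0∞)).map
        (fun p : (PBond (F.P K) (j + 1) → SU N) × GaugeField (F.P K) j (SU N) =>
          {p : (PBond (F.P K) (j + 1) → SU N) × GaugeField (F.P K) j (SU N) |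
              {q : (PBond (F.P K) (j + 1) → SU N) × GaugeField (F.P K) j (SU N) | ∀ c, q.1 c ∈ T c q.2}.indicator
                  (fun q => ∏ c, jd c q.2 (q.1 c)) p ≠ 0 ∧
                (extend centralBond (fun c => ϑ c p.2 (p.1 c)) p.2 : GaugeField (F.P K) j (SU N)) ∈ R}.piecewise
            (fun p => (extend centralBond (fun c => ϑ c p.2 (p.1 c)) p.2 : GaugeField (F.P K) j (SU N))) (fun p => σ p.1) p) := by
  -- road A′'s identity on the window set
  have h0 := fieldMeasure_restrict_eq_map_of_perBondCharts Ω T ϑ jd hj hΩm hTm hθm hjm hΩbl hright hlaw hU₀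
  have hΦtm : Measurable (fun p : ((PBond (F.P K) (j + 1) → SU N) × GaugeField (F.P K) j (SU N)) => (extend centralBond (fun c => ϑ c p.2 (p.1 c)) p.2 : GaugeField (F.P K) j (SU N))) := measurable_triChart_record ϑ hj hθm
  have hJtm : Measurable ({q : ((PBond (F.P K) (j + 1) → SU N) × GaugeField (F.P K) j (SU N)) | ∀ c, q.1 c ∈ T c q.2}.indicator fun q => ∏ c, jd c q.2 (q.1 c)) := measurable_triJacobian_record T jd hTm hjm
  have hAm : MeasurableSet {p : ((PBond (F.P K) (j + 1) → SU N) × GaugeField (F.P K) j (SU N)) | ({q : ((PBond (F.P K) (j + 1) → SU N) × GaugeField (F.P K) j (SU N)) | ∀ c, q.1 c ∈ T c q.2}.indicator fun q => ∏ c, jd c q.2 (q.1 c)) p ≠ 0 ∧ (extend centralBond (fun c => ϑ c p.2 (p.1 c)) p.2 : GaugeField (F.P K) j (SU N)) ∈ R} := measurableSet_rebaseSet T ϑ jd R hj hTm hθm hjm hR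
  have hJ'm : Measurable fun p : ((PBond (F.P K) (j + 1) → SU N) × GaugeField (F.P K) j (SU N)) => ((Set.indicator {p : ((PBond (F.P K) (j + 1) → SU N) × GaugeField (F.P K) j (SU N)) | ({q : ((PBond (F.P K) (j + 1) → SU N) × GaugeField (F.P K) j (SU N)) | ∀ c, q.1 c ∈ T c q.2}.indicator fun q => ∏ c, jd c q.2 (q.1 c)) p ≠ 0 ∧ (extend centralBond (fun c => ϑ c p.2 (p.1 c)) p.2 : GaugeField (F.P K) j (SU N)) ∈ R} ({q : ((PBond (F.P K) (j + 1) → SU N) × GaugeField (F.P K) j (SU N)) | ∀ c, q.1 c ∈ T c q.2}.indicator fun q => ∏ c, jd c q.2 (q.1 c)) p : ℝ≥0) : ℝ≥0∞) :=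
    (hJtm.indicator hAm).coe_nnreal_ennreal
  -- restrict to `R`
  have hset : R ∩ ((avOfRecord F N K j).avg ⁻¹' U₀ ∩ {U | ∀ c, U (centralBond c) ∈ Ω c U}) = (avOfRecord F N K j).avg ⁻¹' U₀ ∩ R := by
    ext U
    constructor
    · rintro ⟨hUR, hU, -⟩; exact ⟨hU, hUR⟩
    · rintro ⟨hU, hUR⟩; exact ⟨hUR, hU, hRW ⟨hU, hUR⟩⟩
  have h1 : (fieldMeasure (F.P K) j (SU N)).restrict ((avOfRecord F N K j).avg ⁻¹' U₀ ∩ R) =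
      ((fieldMeasure (F.P K) j (SU N)).restrict ((avOfRecord F N K j).avg ⁻¹' U₀ ∩ {U | ∀ c, U (centralBond c) ∈ Ω c U})).restrict R := by
    rw [Measure.restrict_restrict hR, hset]
  have hRpre : MeasurableSet ((fun p : ((PBond (F.P K) (j + 1) → SU N) × GaugeField (F.P K) j (SU N)) => (extend centralBond (fun c => ϑ c p.2 (p.1 c)) p.2 : GaugeField (F.P K) j (SU N))) ⁻¹' R) := hΦtm hR
  -- the restricted density is `J′`
  have hJJ : ((fun p : ((PBond (F.P K) (j + 1) → SU N) × GaugeField (F.P K) j (SU N)) => (extend centralBond (fun c => ϑ c p.2 (p.1 c)) p.2 : GaugeField (F.P K) j (SU N))) ⁻¹' R).indicator (fun p => ((({q : ((PBond (F.P K) (j + 1) → SU N) × GaugeField (F.P K) j (SU N)) | ∀ c, q.1 c ∈ T c q.2}.indicator fun q => ∏ c, jd c q.2 (q.1 c)) p : ℝ≥0) : ℝ≥0∞)) =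
      fun p : ((PBond (F.P K) (j + 1) → SU N) × GaugeField (F.P K) j (SU N)) => ((Set.indicator {p : ((PBond (F.P K) (j + 1) → SU N) × GaugeField (F.P K) j (SU N)) | ({q : ((PBond (F.P K) (j + 1) → SU N) × GaugeField (F.P K) j (SU N)) | ∀ c, q.1 c ∈ T c q.2}.indicator fun q => ∏ c, jd c q.2 (q.1 c)) p ≠ 0 ∧ (extend centralBond (fun c => ϑ c p.2 (p.1 c)) p.2 : GaugeField (F.P K) j (SU N)) ∈ R} ({q : ((PBond (F.P K) (j + 1) → SU N) × GaugeField (F.P K) j (SU N)) | ∀ c, q.1 c ∈ T c q.2}.indicator fun q => ∏ c, jd c q.2 (q.1 c)) p : ℝ≥0) : ℝ≥0∞) := by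
    funext p
    by_cases hpR : p ∈ (fun p : ((PBond (F.P K) (j + 1) → SU N) × GaugeField (F.P K) j (SU N)) => (extend centralBond (fun c => ϑ c p.2 (p.1 c)) p.2 : GaugeField (F.P K) j (SU N))) ⁻¹' R
    · rw [Set.indicator_of_mem hpR]
      by_cases hJ0 : ({q : ((PBond (F.P K) (j + 1) → SU N) × GaugeField (F.P K) j (SU N)) | ∀ c, q.1 c ∈ T c q.2}.indicator fun q => ∏ c, jd c q.2 (q.1 c)) p = 0
      · have hpA : p ∉ {p : ((PBond (F.P K) (j + 1) → SU N) × GaugeField (F.P K) j (SU N)) | ({q : ((PBond (F.P K) (j + 1) → SU N) × GaugeField (F.P K) j (SU N)) | ∀ c, q.1 c ∈ T c q.2}.indicator fun q => ∏ c, jd c q.2 (q.1 c)) p ≠ 0 ∧ (extend centralBond (fun c => ϑ c p.2 (p.1 c)) p.2 : GaugeField (F.P K) j (SU N)) ∈ R} := fun h => h.1 hJ0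
        rw [Set.indicator_of_notMem hpA, hJ0]
      · have hpA : p ∈ {p : ((PBond (F.P K) (j + 1) → SU N) × GaugeField (F.P K) j (SU N)) | ({q : ((PBond (F.P K) (j + 1) → SU N) × GaugeField (F.P K) j (SU N)) | ∀ c, q.1 c ∈ T c q.2}.indicator fun q => ∏ c, jd c q.2 (q.1 c)) p ≠ 0 ∧ (extend centralBond (fun c => ϑ c p.2 (p.1 c)) p.2 : GaugeField (F.P K) j (SU N)) ∈ R} := ⟨hJ0, hpR⟩
        rw [Set.indicator_of_mem hpA]
    · have hpA : p ∉ {p : ((PBond (F.P K) (j + 1) → SU N) × GaugeField (F.P K) j (SU N)) | ({q : ((PBond (F.P K) (j + 1) → SU N) × GaugeField (F.P K) j (SU N)) | ∀ c, q.1 c ∈ T c q.2}.indicator fun q => ∏ c, jd c q.2 (q.1 c)) p ≠ 0 ∧ (extend centralBond (fun c => ϑ c p.2 (p.1 c)) p.2 : GaugeField (F.P K) j (SU N)) ∈ R} := fun h => hpR h.2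
      rw [Set.indicator_of_notMem hpR, Set.indicator_of_notMem hpA, ENNReal.coe_zero]
  -- `Φ_tri = Φ′` a.e. for `J′·(dV ⊗ dU)`
  have hae : (fun p : ((PBond (F.P K) (j + 1) → SU N) × GaugeField (F.P K) j (SU N)) => (extend centralBond (fun c => ϑ c p.2 (p.1 c)) p.2 : GaugeField (F.P K) j (SU N))) =ᵐ[(((piHaar (F.P K) (j + 1) (SU N)).restrict U₀).prod (fieldMeasure (F.P K) j (SU N))).withDensity fun p : ((PBond (F.P K) (j + 1) → SU N) × GaugeField (F.P K) j (SU N)) => ((Set.indicator {p : ((PBond (F.P K) (j + 1) → SU N) × GaugeField (F.P K) j (SU N)) | ({q : ((PBond (F.P K) (j + 1) → SU N) × GaugeField (F.P K) j (SU N)) | ∀ c, q.1 c ∈ T c q.2}.indicator fun q => ∏ c, jd c q.2 (q.1 c)) p ≠ 0 ∧ (extend centralBond (fun c => ϑ c p.2 (p.1 c)) p.2 : GaugeField (F.P K) j (SU N)) ∈ R} ({q : ((PBond (F.P K) (j + 1) → SU N) × GaugeField (F.P K) j (SU N)) | ∀ c, q.1 c ∈ T c q.2}.indicator fun q => ∏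 c, jd c q.2 (q.1 c)) p : ℝ≥0) : ℝ≥0∞)]
      Set.piecewise {p : ((PBond (F.P K) (j + 1) → SU N) × GaugeField (F.P K) j (SU N)) | ({q : ((PBond (F.P K) (j + 1) → SU N) × GaugeField (F.P K) j (SU N)) | ∀ c, q.1 c ∈ T c q.2}.indicator fun q => ∏ c, jd c q.2 (q.1 c)) p ≠ 0 ∧ (extend centralBond (fun c => ϑ c p.2 (p.1 c)) p.2 : GaugeField (F.P K) j (SU N)) ∈ R} (fun p : ((PBond (F.P K) (j + 1) → SU N) × GaugeField (F.P K) j (SU N)) => (extend centralBond (fun c => ϑ c p.2 (p.1 c)) p.2 : GaugeField (F.P K) j (SU N))) (fun p => σ p.1) := by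
    rw [Filter.EventuallyEq, ae_withDensity_iff hJ'm]
    refine Filter.Eventually.of_forall fun p hp => ?_
    have hpA : p ∈ {p : ((PBond (F.P K) (j + 1) → SU N) × GaugeField (F.P K) j (SU N)) | ({q : ((PBond (F.P K) (j + 1) → SU N) × GaugeField (F.P K) j (SU N)) | ∀ c, q.1 c ∈ T c q.2}.indicator fun q => ∏ c, jd c q.2 (q.1 c)) p ≠ 0 ∧ (extend centralBond (fun c => ϑ c p.2 (p.1 c)) p.2 : GaugeField (F.P K) j (SU N)) ∈ R} := by
      by_contra h
      exact hp (by rw [Set.indicator_of_notMem h, ENNReal.coe_zero])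
    rw [Set.piecewise_eq_of_mem _ _ _ hpA]
  have h3 : ((((piHaar (F.P K) (j + 1) (SU N)).restrict U₀).prod (fieldMeasure (F.P K) j (SU N))).withDensity fun p => ((({q : ((PBond (F.P K) (j + 1) → SU N) × GaugeField (F.P K) j (SU N)) | ∀ c, q.1 c ∈ T c q.2}.indicator fun q => ∏ c, jd c q.2 (q.1 c)) p : ℝ≥0) : ℝ≥0∞)).restrict ((fun p : ((PBond (F.P K) (j + 1) → SU N) × GaugeField (F.P K) j (SU N)) => (extend centralBond (fun c => ϑ c p.2 (p.1 c)) p.2 : GaugeField (F.P K) j (SU N))) ⁻¹' R) =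
      (((piHaar (F.P K) (j + 1) (SU N)).restrict U₀).prod (fieldMeasure (F.P K) j (SU N))).withDensity (((fun p : ((PBond (F.P K) (j + 1) → SU N) × GaugeField (F.P K) j (SU N)) => (extend centralBond (fun c => ϑ c p.2 (p.1 c)) p.2 : GaugeField (F.P K) j (SU N))) ⁻¹' R).indicator fun p => ((({q : ((PBond (F.P K) (j + 1) → SU N) × GaugeField (F.P K) j (SU N)) | ∀ c, q.1 c ∈ T c q.2}.indicator fun q => ∏ c, jd c q.2 (q.1 c)) p : ℝ≥0) : ℝ≥0∞)) := by
    rw [restrict_withDensity hRpre, withDensity_indicator hRpre]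
  calc (fieldMeasure (F.P K) j (SU N)).restrict ((avOfRecord F N K j).avg ⁻¹' U₀ ∩ R)
      = ((fieldMeasure (F.P K) j (SU N)).restrict ((avOfRecord F N K j).avg ⁻¹' U₀ ∩ {U | ∀ c, U (centralBond c) ∈ Ω c U})).restrict R := h1
    _ = (Measure.map (fun p : ((PBond (F.P K) (j + 1) → SU N) × GaugeField (F.P K) j (SU N)) => (extend centralBond (fun c => ϑ c p.2 (p.1 c)) p.2 : GaugeField (F.P K) j (SU N))) ((((piHaar (F.P K) (j + 1) (SU N)).restrict U₀).prod (fieldMeasure (F.P K) j (SU N))).withDensity fun p => ((({q : ((PBond (F.P K) (j + 1) → SU N) × GaugeField (F.P K) j (SU N)) | ∀ c, q.1 c ∈ T c q.2}.indicator fun q => ∏ c, jd c q.2 (q.1 c)) p : ℝ≥0) : ℝ≥0∞))).restrict R :=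
        congrArg (fun μ => Measure.restrict μ R) h0
    _ = Measure.map (fun p : ((PBond (F.P K) (j + 1) → SU N) × GaugeField (F.P K) j (SU N)) => (extend centralBond (fun c => ϑ c p.2 (p.1 c)) p.2 : GaugeField (F.P K) j (SU N))) (((((piHaar (F.P K) (j + 1) (SU N)).restrict U₀).prod (fieldMeasure (F.P K) j (SU N))).withDensity fun p => ((({q : ((PBond (F.P K) (j + 1) → SU N) × GaugeField (F.P K) j (SU N)) | ∀ c, q.1 c ∈ T c q.2}.indicator fun q => ∏ c, jd c q.2 (q.1 c)) p : ℝ≥0) : ℝ≥0∞)).restrict ((fun p : ((PBond (F.P K) (j + 1) → SU N) × GaugeField (F.P K) j (SU N)) => (extend centralBond (fun c => ϑ c p.2 (p.1 c)) p.2 : GaugeField (F.P K) j (SU N))) ⁻¹' R)) :=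
        Measure.restrict_map hΦtm hR
    _ = Measure.map (fun p : ((PBond (F.P K) (j + 1) → SU N) × GaugeField (F.P K) j (SU N)) => (extend centralBond (fun c => ϑ c p.2 (p.1 c)) p.2 : GaugeField (F.P K) j (SU N))) ((((piHaar (F.P K) (j + 1) (SU N)).restrict U₀).prod (fieldMeasure (F.P K) j (SU N))).withDensity (((fun p : ((PBond (F.P K) (j + 1) → SU N) × GaugeField (F.P K) j (SU N)) => (extend centralBond (fun c => ϑ c p.2 (p.1 c)) p.2 : GaugeField (F.P K) j (SU N))) ⁻¹' R).indicator fun p => ((({q : ((PBond (F.P K) (j + 1) → SU N) × GaugeField (F.P K) j (SU N)) | ∀ c, q.1 c ∈ T c q.2}.indicator fun q => ∏ c, jd c q.2 (q.1 c)) p : ℝ≥0) : ℝ≥0∞))) :=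
        congrArg (fun μ => Measure.map (fun p : ((PBond (F.P K) (j + 1) → SU N) × GaugeField (F.P K) j (SU N)) => (extend centralBond (fun c => ϑ c p.2 (p.1 c)) p.2 : GaugeField (F.P K) j (SU N))) μ) h3
    _ = Measure.map (fun p : ((PBond (F.P K) (j + 1) → SU N) × GaugeField (F.P K) j (SU N)) => (extend centralBond (fun c => ϑ c p.2 (p.1 c)) p.2 : GaugeField (F.P K) j (SU N))) ((((piHaar (F.P K) (j + 1) (SU N)).restrict U₀).prod (fieldMeasure (F.P K) j (SU N))).withDensity fun p : ((PBond (F.P K) (j + 1) → SU N) × GaugeField (F.P K) j (SU N)) => ((Set.indicator {p : ((PBond (F.P K) (j + 1) → SU N) × GaugeField (F.P K) j (SU N)) | ({q : ((PBond (F.P K) (j + 1) → SU N) × GaugeField (F.P K) j (SU N)) | ∀ c, q.1 c ∈ T c q.2}.indicator fun q => ∏ c, jd c q.2 (q.1 c)) p ≠ 0 ∧ (extend centralBond (fun c => ϑ c p.2 (p.1 c)) p.2 : GaugeField (F.P K) j (SU N)) ∈ R} ({q : ((PBond (F.P K) (j + 1) → SU N) × GaugeField (F.P K) j (SU N)) |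 ∀ c, q.1 c ∈ T c q.2}.indicator fun q => ∏ c, jd c q.2 (q.1 c)) p : ℝ≥0) : ℝ≥0∞)) :=
        congrArg (fun d => Measure.map (fun p : ((PBond (F.P K) (j + 1) → SU N) × GaugeField (F.P K) j (SU N)) => (extend centralBond (fun c => ϑ c p.2 (p.1 c)) p.2 : GaugeField (F.P K) j (SU N))) ((((piHaar (F.P K) (j + 1) (SU N)).restrict U₀).prod (fieldMeasure (F.P K) j (SU N))).withDensity d)) hJJ
    _ = Measure.map (Set.piecewise {p : ((PBond (F.P K) (j + 1) → SU N) × GaugeField (F.P K) j (SU N)) | ({q : ((PBond (F.P K) (j + 1) → SU N) × GaugeField (F.P K) j (SU N)) | ∀ c, q.1 c ∈ T c q.2}.indicator fun q => ∏ c, jd c q.2 (q.1 c)) p ≠ 0 ∧ (extend centralBond (fun c => ϑ c p.2 (p.1 c)) p.2 : GaugeField (F.P K) j (SU N)) ∈ R} (fun p : ((PBond (F.P K) (j + 1) → SU N) × GaugeField (F.P K) j (SU N)) => (extend centralBond (fun c => ϑ c p.2 (p.1 c)) p.2 : GaugeField (F.P K) j (SU N))) (fun p => σ p.1))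
          ((((piHaar (F.P K) (j + 1) (SU N)).restrict U₀).prod (fieldMeasure (F.P K) j (SU N))).withDensity fun p : ((PBond (F.P K) (j + 1) → SU N) × GaugeField (F.P K) j (SU N)) => ((Set.indicator {p : ((PBond (F.P K) (j + 1) → SU N) × GaugeField (F.P K) j (SU N)) | ({q : ((PBond (F.P K) (j + 1) → SU N) × GaugeField (F.P K) j (SU N)) | ∀ c, q.1 c ∈ T c q.2}.indicator fun q => ∏ c, jd c q.2 (q.1 c)) p ≠ 0 ∧ (extend centralBond (fun c => ϑ c p.2 (p.1 c)) p.2 : GaugeField (F.P K) j (SU N)) ∈ R} ({q : ((PBond (F.P K) (j + 1) → SU N) × GaugeField (F.P K) j (SU N)) | ∀ c, q.1 c ∈ T c q.2}.indicator fun q => ∏ c, jd c q.2 (q.1 c)) p : ℝ≥0) : ℝ≥0∞)) := Measure.map_congr hae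

end Map

end Summit.QuantumFields.YangMills.BalabanUVNodes.N09TowerChartOfPerBondCharts

end
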